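import Summits.KontsevichZagierPeriods.KontsevichZagierPeriods.Theorems.ComplexOrientationsComplexOrientationIdentityEllipse
import Summits.KontsevichZagierPeriods.KontsevichZagierPeriods.Theorems.ComplexOrientationsComplexOrientationIdentityConicsAux
import Literature.AlgebraicGeometry.RealAlgebraic.DividingCurves
import HarnessLib

/-!
# Route ComplexOrientations — `ComplexOrientationIdentity` for conics (unconditional calibration)

The values item `ComplexOrientationIdentity` (stmt-KontsevichZagierPeriods-11371) of route
`KontsevichZagierPeriods/ComplexOrientations` — on a dividing nonsingular geometrically irreducible
real plane curve over `ℚ` with compact real locus, a unit-signed sum of the areas of the interiors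
of the ovals is a non-negative real-algebraic multiple of `π` — is Rokhlin's complex orientation
formula integrated and is out of reach in general (see `…ComplexOrientationIdentity.lean`, where
it is reduced to two named facts). This file PROVES it for curves of total degree `≤ 2`
(`complexOrientationIdentity_of_totalDegree_le_two`), the genus-`0` calibration of the item:

1. (`posDef_of_pos_near_infinity`) a polynomial of degree `≤ 2` with compact real zero locus has
   constant sign outside a ball; positivity there makes the leading form positive semidefinite
   with the linear part vanishing on its kernel, and every degenerate case (rank `≤ 1`) is a
   constant or a quadratic in one linear form, reducible over `ℂ` — so irreducibility over `ℂ`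
   forces a positive definite leading form;
2. (`realLocus_quadric_eq_ellipse`) completing the square at the rational centre, the real locus
   is the ellipse `{Q(v − c₀) = ρ}`, and `ρ > 0` because `ρ = 0` would make the centre a real
   point at which both partial derivatives vanish (excluded by nonsingularity);
3. (companion file `…Ellipse`) the ellipse is connected, so there is exactly ONE oval, its
   `ovalInterior` is the inside of the ellipse, of area `2πρ/√(4ac − b²)`;
4. hence `η = 1`, `β = 2ρ/√(4ac − b²) ≥ 0`, algebraic since `ρ, a, b, c ∈ ℚ`.

The dividing hypothesis is not needed in degree `≤ 2` (an ellipse is dividing anyway).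
Everything is proved (theorems only, standard axioms).
-/

noncomputable section

open MvPolynomial Set MeasureTheory
open Literature.AlgebraicGeometry.RealAlgebraic (ovalInterior mem_ovalInterior_iff)
open Literature.Algebra.EuclideanLattices
open Literature.NumberTheory.Transcendental

namespace Summit.KontsevichZagierPeriods.ComplexOrientations

/-! ### Classification of the admissible conics -/

/-- **The leading form of an admissible conic is positive definite.** If the real quadratic
`a x₀² + b x₀x₁ + c x₁² + d x₀ + e x₁ + f` (`a, …, f ∈ ℚ`) is positive near infinity and the
polynomial is irreducible over `ℂ`, then `a > 0` and `4ac − b² > 0` (all degenerate cases factor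
over `ℂ`). [folklore] -/
theorem posDef_of_pos_near_infinity {a b c d e f : ℚ} {M : ℝ}
    (hpos : ∀ v : Fin 2 → ℝ, M < ‖v‖ →
      0 < (a : ℝ) * v 0 ^ 2 + b * (v 0 * v 1) + c * v 1 ^ 2 + d * v 0 + e * v 1 + f)
    (hirr : Irreducible (map (algebraMap ℚ ℂ)
      (C a * X 0 ^ 2 + C b * (X 0 * X 1) + C c * X 1 ^ 2 + C d * X 0 + C e * X 1 + C f :
        MvPolynomial (Fin 2) ℚ))) :
    0 < a ∧ 0 < 4 * a * c - b ^ 2 := by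
  have hq := leadingForm_nonneg hpos
  have hk := linearPart_eq_zero_of_leadingForm_eq_zero hpos
  have ha : 0 ≤ a := by
    have := hq (Pi.single 0 1)
    simp at this
    exact_mod_cast this
  have hc : 0 ≤ c := by
    have := hq (Pi.single 1 1)
    simp at this
    exact_mod_cast this
  rcases ha.eq_or_lt with ha0 | ha0
  · -- `a = 0`: then `b = 0`, and the polynomial is a polynomial in `x₁` alone
    exfalso
    subst ha0
    have hb0 : b = 0 := by
      have h' : ∀ t : ℝ, 0 ≤ (b : ℝ) * t + c * t ^ 2 := fun t => by
        have := hq ![1, t]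
        simp at this
        linarith
      exact_mod_cast eq_zero_of_forall_linear_add_sq_nonneg (by exact_mod_cast hc) h'
    subst hb0
    have hd0 : d = 0 := by
      have := hk (Pi.single 0 1) (by simp)
      simp at this
      exact_mod_cast this
    subst hd0
    rcases hc.eq_or_lt with hc0 | hc0
    · subst hc0
      have he0 : e = 0 := by
        have := hk (Pi.single 1 1) (by simp)
        simp at this
        exact_mod_cast this
      subst he0
      refine not_irreducible_map_C f ?_
      simpa using hirr
    · refine not_irreducible_of_C_mul_eq _ (4 * c) 0 (2 * c) e (4 * c * f) (by positivity)
        (Or.inr (by positivity)) ?_ hirr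
      simp only [map_zero, map_mul, map_ofNat, zero_mul, zero_add]
      ring
  · -- `a > 0`
    refine ⟨ha0, ?_⟩
    have hDnn : 0 ≤ 4 * a * c - b ^ 2 := by
      have := hq ![-b, 2 * a]
      simp at this
      have h' : (0 : ℝ) ≤ a * (4 * a * c - b ^ 2) := by nlinarith
      have h'' : (0 : ℚ) ≤ a * (4 * a * c - b ^ 2) := by exact_mod_cast h'
      nlinarith
    rcases hDnn.eq_or_lt with hD0 | hD0
    · exfalso
      -- the kernel vector `(-b, 2a)` kills the linear part: `2ae = bd`
      have hker : 2 * a * e = b * d := by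
        have h1 := hk ![-b, 2 * a] (by
          simp
          have : (a : ℝ) * (4 * a * c - b ^ 2) = 0 := by exact_mod_cast (by rw [← hD0, mul_zero])
          nlinarith)
        simp at h1
        have : (2 * a * e : ℝ) = b * d := by linarith
        exact_mod_cast this
      refine not_irreducible_of_C_mul_eq _ (4 * a) (2 * a) b d (4 * a * f) (by positivity)
        (Or.inl (by positivity)) ?_ hirr
      have h1 : (C b : MvPolynomial (Fin 2) ℚ) ^ 2 = 4 * C a * C c := by
        rw [← map_pow, show b ^ 2 = 4 * a * c by linarith, map_mul, map_mul, map_ofNat]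
      have h2 : 2 * C a * C e = (C b * C d : MvPolynomial (Fin 2) ℚ) := by
        rw [← map_mul, ← map_ofNat C 2, ← map_mul, ← map_mul, hker]
      simp only [map_mul, map_ofNat]
      linear_combination (-(X 1 : MvPolynomial (Fin 2) ℚ) ^ 2) * h1 + (2 * X 1) * h2
    · exact hD0

/-- **The real locus of an admissible conic is an ellipse.** For the quadric with `a > 0`,
`D = 4ac − b² > 0`, nonsingular complex curve and non-empty real locus: the real locus is
`{Q(v − c₀) = ρ}` with `Q = a x₀² + b x₀x₁ + c x₁²`, the rational centre `c₀` and a rational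
`ρ > 0` (smoothness excludes the point-ellipse `ρ = 0`). [folklore] -/
theorem realLocus_quadric_eq_ellipse {a b c d e f : ℚ} (ha : 0 < a) (hD : 0 < 4 * a * c - b ^ 2)
    (hsm : ∀ w : Fin 2 → ℂ, aeval w (C a * X 0 ^ 2 + C b * (X 0 * X 1) + C c * X 1 ^ 2 + C d * X 0 +
      C e * X 1 + C f : MvPolynomial (Fin 2) ℚ) = 0 → ∃ i, aeval w (pderiv i (C a * X 0 ^ 2 +
      C b * (X 0 * X 1) + C c * X 1 ^ 2 + C d * X 0 + C e * X 1 + C f : MvPolynomial (Fin 2) ℚ)) ≠ 0)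
    (hne : ∃ v : Fin 2 → ℝ, aeval v (C a * X 0 ^ 2 + C b * (X 0 * X 1) + C c * X 1 ^ 2 + C d * X 0 +
      C e * X 1 + C f : MvPolynomial (Fin 2) ℚ) = 0) :
    ∃ (c₀ : Fin 2 → ℝ) (ρ : ℚ), 0 < ρ ∧
      {v : Fin 2 → ℝ | aeval v (C a * X 0 ^ 2 + C b * (X 0 * X 1) + C c * X 1 ^ 2 + C d * X 0 +
        C e * X 1 + C f : MvPolynomial (Fin 2) ℚ) = 0} =
      {v | (a : ℝ) * (v - c₀) 0 ^ 2 + b * ((v - c₀) 0 * (v - c₀) 1) + c * (v - c₀) 1 ^ 2 = ρ} := by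
  set D : ℚ := 4 * a * c - b ^ 2 with hDdef
  have hD0 : D ≠ 0 := hD.ne'
  set x₀ : ℚ := (b * e - 2 * c * d) / D with hx₀
  set y₀ : ℚ := (b * d - 2 * a * e) / D with hy₀
  set ρ : ℚ := -(a * x₀ ^ 2 + b * (x₀ * y₀) + c * y₀ ^ 2 + d * x₀ + e * y₀ + f) with hρ
  -- the centre kills the gradient
  have hg0 : 2 * a * x₀ + b * y₀ + d = 0 := by
    rw [hx₀, hy₀]; field_simp; ring
  have hg1 : b * x₀ + 2 * c * y₀ + e = 0 := by
    rw [hx₀, hy₀]; field_simp; ring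
  have hg0R : (2 * a * x₀ + b * y₀ + d : ℝ) = 0 := by exact_mod_cast hg0
  have hg1R : (b * x₀ + 2 * c * y₀ + e : ℝ) = 0 := by exact_mod_cast hg1
  -- completing the square at the centre
  have key : ∀ v : Fin 2 → ℝ, (a : ℝ) * v 0 ^ 2 + b * (v 0 * v 1) + c * v 1 ^ 2 + d * v 0 + e * v 1 + f
      = (a : ℝ) * (v 0 - x₀) ^ 2 + b * ((v 0 - x₀) * (v 1 - y₀)) + c * (v 1 - y₀) ^ 2 - ρ := by
    intro v
    rw [hρ]
    push_cast
    linear_combination (v 0 - x₀ : ℝ) * hg0R + (v 1 - y₀ : ℝ) * hg1R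
  set c₀ : Fin 2 → ℝ := ![(x₀ : ℝ), (y₀ : ℝ)] with hc₀
  have hQ : ∀ w : Fin 2 → ℝ, (fun w : Fin 2 → ℝ => (a : ℝ) * w 0 ^ 2 + b * (w 0 * w 1) + c * w 1 ^ 2) w
      = (a : ℝ) * w 0 ^ 2 + b * (w 0 * w 1) + c * w 1 ^ 2 := fun _ => rfl
  have haR : (0 : ℝ) < a := by exact_mod_cast ha
  have hDR : (0 : ℝ) < 4 * (a : ℝ) * c - (b : ℝ) ^ 2 := by exact_mod_cast hD
  -- `ρ > 0`
  obtain ⟨v₁, hv₁⟩ := hne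
  rw [aeval_quadric_real, key] at hv₁
  have hρnn : (0 : ℝ) ≤ ρ := by
    have := binQF_nonneg hQ haR hDR ![v₁ 0 - x₀, v₁ 1 - y₀]
    simp at this
    linarith
  have hρpos : (0 : ℝ) < ρ := by
    rcases hρnn.eq_or_lt with h0 | h0
    · exfalso
      -- `ρ = 0`: the real point `v₁` is the centre, a singular point
      have hq0 : (a : ℝ) * (v₁ 0 - x₀) ^ 2 + b * ((v₁ 0 - x₀) * (v₁ 1 - y₀)) + c * (v₁ 1 - y₀) ^ 2 = 0 := by
        linarith
      have hm := binQF_min_pos haR hDR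
      have hw0 : v₁ 0 - x₀ = 0 := by
        have := binQF_coord_sq_le hQ haR hDR ![v₁ 0 - x₀, v₁ 1 - y₀] 0
        simp only [Matrix.cons_val_zero, Matrix.cons_val_one] at this
        rw [hq0] at this
        have h2 : (v₁ 0 - x₀) ^ 2 ≤ 0 := by nlinarith [sq_nonneg (v₁ 0 - x₀)]
        exact pow_eq_zero_iff two_ne_zero |>.1 (le_antisymm h2 (sq_nonneg _))
      have hw1 : v₁ 1 - y₀ = 0 := by
        have := binQF_coord_sq_le hQ haR hDR ![v₁ 0 - x₀, v₁ 1 - y₀] 1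
        simp only [Matrix.cons_val_zero, Matrix.cons_val_one] at this
        rw [hq0] at this
        have h2 : (v₁ 1 - y₀) ^ 2 ≤ 0 := by nlinarith [sq_nonneg (v₁ 1 - y₀)]
        exact pow_eq_zero_iff two_ne_zero |>.1 (le_antisymm h2 (sq_nonneg _))
      have hv₁c : v₁ = c₀ := by
        ext i; fin_cases i
        · simp [hc₀]; linarith
        · simp [hc₀]; linarith
      -- smoothness at the complex point `c₀`: both partial derivatives vanish there
      have hd0 : aeval (fun j => (c₀ j : ℂ)) (pderiv 0 (C a * X 0 ^ 2 + C b * (X 0 * X 1) +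
          C c * X 1 ^ 2 + C d * X 0 + C e * X 1 + C f : MvPolynomial (Fin 2) ℚ)) = 0 := by
        rw [pderiv_zero_quadric, Literature.AlgebraicGeometry.RealAlgebraic.aeval_ofReal,
          Complex.ofReal_eq_zero]
        simp only [map_add, map_mul, aeval_C, aeval_X, eq_ratCast, hc₀, Matrix.cons_val_zero,
          Matrix.cons_val_one]
        push_cast
        linarith [hg0R]
      have hd1 : aeval (fun j => (c₀ j : ℂ)) (pderiv 1 (C a * X 0 ^ 2 + C b * (X 0 * X 1) +
          C c * X 1 ^ 2 + C d * X 0 + C e * X 1 + C f : MvPolynomial (Fin 2) ℚ)) = 0 := by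
        rw [pderiv_one_quadric, Literature.AlgebraicGeometry.RealAlgebraic.aeval_ofReal,
          Complex.ofReal_eq_zero]
        simp only [map_add, map_mul, aeval_C, aeval_X, eq_ratCast, hc₀, Matrix.cons_val_zero,
          Matrix.cons_val_one]
        push_cast
        linarith [hg1R]
      obtain ⟨i, hi⟩ := hsm (fun j => (c₀ j : ℂ)) (by
        rw [Literature.AlgebraicGeometry.RealAlgebraic.aeval_ofReal, aeval_quadric_real, key,
          ← hv₁c, hq0, ← h0, sub_zero, Complex.ofReal_zero])
      fin_cases i
      · exact hi hd0
      · exact hi hd1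
    · exact h0
  refine ⟨c₀, ρ, by exact_mod_cast hρpos, ?_⟩
  ext v
  simp only [mem_setOf_eq, aeval_quadric_real, key, Pi.sub_apply, hc₀, Matrix.cons_val_zero,
    Matrix.cons_val_one, sub_eq_zero]

/-- **The ellipse package of an admissible conic.** For the quadric `a x₀² + ⋯ + f` positive near
infinity, irreducible over `ℂ`, with nonsingular complex curve and non-empty real locus: the real
locus is an ellipse `{Q(v − c₀) = ρ}` for a positive definite form `Q = A x₀² + B x₀x₁ + C x₁²`,
`ρ > 0`, and its inside has area `2πρ/√(4AC − B²) = β π` with `β ≥ 0` real algebraic.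
[folklore] -/
theorem exists_ellipse_of_quadric (a b c d e f : ℚ) {M : ℝ}
    (hpos : ∀ v : Fin 2 → ℝ, M < ‖v‖ →
      0 < (a : ℝ) * v 0 ^ 2 + b * (v 0 * v 1) + c * v 1 ^ 2 + d * v 0 + e * v 1 + f)
    (hirr : Irreducible (map (algebraMap ℚ ℂ) (C a * X 0 ^ 2 + C b * (X 0 * X 1) + C c * X 1 ^ 2 +
      C d * X 0 + C e * X 1 + C f : MvPolynomial (Fin 2) ℚ)))
    (hsm : ∀ w : Fin 2 → ℂ, aeval w (C a * X 0 ^ 2 + C b * (X 0 * X 1) + C c * X 1 ^ 2 + C d * X 0 +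
      C e * X 1 + C f : MvPolynomial (Fin 2) ℚ) = 0 → ∃ i, aeval w (pderiv i (C a * X 0 ^ 2 +
      C b * (X 0 * X 1) + C c * X 1 ^ 2 + C d * X 0 + C e * X 1 + C f : MvPolynomial (Fin 2) ℚ)) ≠ 0)
    (hne : ∃ v : Fin 2 → ℝ, aeval v (C a * X 0 ^ 2 + C b * (X 0 * X 1) + C c * X 1 ^ 2 + C d * X 0 +
      C e * X 1 + C f : MvPolynomial (Fin 2) ℚ) = 0) :
    ∃ (A B C' : ℝ) (c₀ : Fin 2 → ℝ) (ρ β : ℝ), 0 < A ∧ 0 < 4 * A * C' - B ^ 2 ∧ 0 < ρ ∧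
      IsAlgebraic ℚ β ∧ 0 ≤ β ∧ 2 * Real.pi / Real.sqrt (4 * A * C' - B ^ 2) * ρ = β * Real.pi ∧
      {v : Fin 2 → ℝ | aeval v (C a * X 0 ^ 2 + C b * (X 0 * X 1) + C c * X 1 ^ 2 + C d * X 0 +
        C e * X 1 + C f : MvPolynomial (Fin 2) ℚ) = 0} =
      {v | A * (v - c₀) 0 ^ 2 + B * ((v - c₀) 0 * (v - c₀) 1) + C' * (v - c₀) 1 ^ 2 = ρ} := by
  obtain ⟨ha, hD⟩ := posDef_of_pos_near_infinity hpos hirr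
  obtain ⟨c₀, ρ, hρ, hZ⟩ := realLocus_quadric_eq_ellipse ha hD hsm hne
  have hρR : (0 : ℝ) < ρ := by exact_mod_cast hρ
  have hDR : (0 : ℝ) < ((4 * a * c - b ^ 2 : ℚ) : ℝ) := by exact_mod_cast hD
  refine ⟨a, b, c, c₀, ρ, 2 / Real.sqrt ((4 * a * c - b ^ 2 : ℚ) : ℝ) * ρ, by exact_mod_cast ha,
    by push_cast at hDR ⊢; exact hDR, hρR, isAlgebraic_two_div_sqrt_mul hD, by positivity, ?_, hZ⟩
  push_cast
  ring

/-- **`ComplexOrientationIdentity` for conics (unconditional calibration slice).** For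
`p ∈ ℚ[x₀, x₁]` of total degree `≤ 2` satisfying the hypotheses of the values item
`ComplexOrientationIdentity` of route `KontsevichZagierPeriods/ComplexOrientations` (compact real
locus, nonsingular complex curve, geometrically irreducible, dividing), the conclusion holds: either
there is no oval (`k = 0`, `β = 0`), or `p` is an ellipse over `ℚ`, its real locus is ONE oval
(`k = 1`), the oval's interior is the inside of the ellipse and its area is `2πρ/√(4ac − b²)`, a
non-negative real-algebraic multiple of `π` (`η = 1`). The dividing hypothesis is not used.
[folklore] -/
theorem complexOrientationIdentity_of_totalDegree_le_two (p : MvPolynomial (Fin 2) ℚ)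
    (hdeg : p.totalDegree ≤ 2) :
    IsCompact {v : Fin 2 → ℝ | aeval v p = 0} →
    (∀ w : Fin 2 → ℂ, aeval w p = 0 → ∃ i, aeval w (pderiv i p) ≠ 0) →
    Irreducible (map (algebraMap ℚ ℂ) p) →
    ¬ IsPreconnected {w : Fin 2 → ℂ | aeval w p = 0 ∧ ∃ i, (w i).im ≠ 0} →
    ∀ (k : ℕ) (O : Fin k → Set (Fin 2 → ℝ)) (s : Fin k → KZ.IntegralRep 2),
      (∀ i, ∃ v : Fin 2 → ℝ, aeval v p = 0 ∧
        O i = connectedComponentIn {u : Fin 2 → ℝ | aeval u p = 0} v) →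
      Function.Injective O →
      (∀ v : Fin 2 → ℝ, aeval v p = 0 → ∃ i, v ∈ O i) →
      (∀ i, (s i).domain =
        {v : Fin 2 → ℝ | v ∉ O i ∧ Bornology.IsBounded (connectedComponentIn (O i)ᶜ v)}) →
      (∀ i, ∀ v ∈ (s i).domain, (s i).integrand v = 1) →
      ∃ (η : Fin k → ℤ) (β : ℝ), (∀ i, η i = 1 ∨ η i = -1) ∧ IsAlgebraic ℚ β ∧ 0 ≤ β ∧
        ∑ i, (η i : ℝ) * (s i).value = β * Real.pi := by
  intro hcpt hsm hirr _ k O s hO hinj _ hdom hone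
  -- `k = 0`: nothing to prove
  rcases Nat.eq_zero_or_pos k with hk | hk
  · subst hk
    exact ⟨fun _ => 1, 0, fun i => i.elim0, isAlgebraic_zero, le_rfl, by simp⟩
  obtain ⟨v₀, hv₀, -⟩ := hO ⟨0, hk⟩
  -- normal form of `p`
  obtain ⟨a, b, c, d, e, f, rfl⟩ := exists_eq_quadric_of_totalDegree_le_two p hdeg
  -- the sign of `p` near infinity is constant
  obtain ⟨M, hM⟩ := hcpt.isBounded.exists_norm_le
  have hne0 : ∀ v : Fin 2 → ℝ, M < ‖v‖ →
      (a : ℝ) * v 0 ^ 2 + b * (v 0 * v 1) + c * v 1 ^ 2 + d * v 0 + e * v 1 + f ≠ 0 := by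
    intro v hv h0
    have := hM v (by rw [mem_setOf_eq, aeval_quadric_real]; exact h0)
    linarith
  have hcont : Continuous fun v : Fin 2 → ℝ =>
      (a : ℝ) * v 0 ^ 2 + b * (v 0 * v 1) + c * v 1 ^ 2 + d * v 0 + e * v 1 + f := by
    fun_prop
  -- the ellipse package, in either sign case
  obtain ⟨A, B, C', c₀, ρ, β, hA, hD, hρ, hβ, hβ0, hβπ, hZ⟩ : ∃ (A B C' : ℝ) (c₀ : Fin 2 → ℝ)
      (ρ β : ℝ), 0 < A ∧ 0 < 4 * A * C' - B ^ 2 ∧ 0 < ρ ∧ IsAlgebraic ℚ β ∧ 0 ≤ β ∧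
      2 * Real.pi / Real.sqrt (4 * A * C' - B ^ 2) * ρ = β * Real.pi ∧
      {v : Fin 2 → ℝ | aeval v (C a * X 0 ^ 2 + C b * (X 0 * X 1) + C c * X 1 ^ 2 + C d * X 0 +
        C e * X 1 + C f : MvPolynomial (Fin 2) ℚ) = 0} =
      {v | A * (v - c₀) 0 ^ 2 + B * ((v - c₀) 0 * (v - c₀) 1) + C' * (v - c₀) 1 ^ 2 = ρ} := by
    rcases forall_pos_or_forall_neg_of_isPreconnected (isPreconnected_setOf_lt_norm M) hcont hne0
      with hpos | hneg
    · exact exists_ellipse_of_quadric a b c d e f hpos hirr hsm ⟨v₀, hv₀⟩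
    · -- replace `p` by `-p`
      have hq : (C (-a) * X 0 ^ 2 + C (-b) * (X 0 * X 1) + C (-c) * X 1 ^ 2 + C (-d) * X 0 +
          C (-e) * X 1 + C (-f) : MvPolynomial (Fin 2) ℚ) = -(C a * X 0 ^ 2 + C b * (X 0 * X 1) +
          C c * X 1 ^ 2 + C d * X 0 + C e * X 1 + C f) := by
        simp only [map_neg]
        ring
      have hpos' : ∀ v : Fin 2 → ℝ, M < ‖v‖ → 0 < ((-a : ℚ) : ℝ) * v 0 ^ 2 +
          ((-b : ℚ) : ℝ) * (v 0 * v 1) + ((-c : ℚ) : ℝ) * v 1 ^ 2 + ((-d : ℚ) : ℝ) * v 0 +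
          ((-e : ℚ) : ℝ) * v 1 + ((-f : ℚ) : ℝ) := by
        intro v hv
        have := hneg v hv
        push_cast
        linarith
      have hirr' : Irreducible (map (algebraMap ℚ ℂ) (C (-a) * X 0 ^ 2 + C (-b) * (X 0 * X 1) +
          C (-c) * X 1 ^ 2 + C (-d) * X 0 + C (-e) * X 1 + C (-f) : MvPolynomial (Fin 2) ℚ)) := by
        rw [hq, map_neg]
        exact (Associated.refl _).neg_right.irreducible hirr
      have hsm' : ∀ w : Fin 2 → ℂ, aeval w (C (-a) * X 0 ^ 2 + C (-b) * (X 0 * X 1) +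
          C (-c) * X 1 ^ 2 + C (-d) * X 0 + C (-e) * X 1 + C (-f) : MvPolynomial (Fin 2) ℚ) = 0 →
          ∃ i, aeval w (pderiv i (C (-a) * X 0 ^ 2 + C (-b) * (X 0 * X 1) + C (-c) * X 1 ^ 2 +
          C (-d) * X 0 + C (-e) * X 1 + C (-f) : MvPolynomial (Fin 2) ℚ)) ≠ 0 := by
        intro w hw
        rw [hq, map_neg, neg_eq_zero] at hw
        obtain ⟨i, hi⟩ := hsm w hw
        exact ⟨i, by rwa [hq, map_neg, map_neg, neg_ne_zero]⟩
      have hne' : ∃ v : Fin 2 → ℝ, aeval v (C (-a) * X 0 ^ 2 + C (-b) * (X 0 * X 1) +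
          C (-c) * X 1 ^ 2 + C (-d) * X 0 + C (-e) * X 1 + C (-f) : MvPolynomial (Fin 2) ℚ) = 0 :=
        ⟨v₀, by rw [hq, map_neg, neg_eq_zero]; exact hv₀⟩
      obtain ⟨A, B, C', c₀, ρ, β, hA, hD, hρ, hβ, hβ0, hβπ, hZ⟩ :=
        exists_ellipse_of_quadric (-a) (-b) (-c) (-d) (-e) (-f) hpos' hirr' hsm' hne'
      refine ⟨A, B, C', c₀, ρ, β, hA, hD, hρ, hβ, hβ0, hβπ, ?_⟩
      rw [← hZ]
      ext v
      rw [mem_setOf_eq, mem_setOf_eq, hq, map_neg, neg_eq_zero]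
  -- the positive definite form of the ellipse
  set Q : (Fin 2 → ℝ) → ℝ := fun w => A * w 0 ^ 2 + B * (w 0 * w 1) + C' * w 1 ^ 2 with hQdef
  have hQ : ∀ w, Q w = A * w 0 ^ 2 + B * (w 0 * w 1) + C' * w 1 ^ 2 := fun _ => rfl
  have hZ' : {v : Fin 2 → ℝ | aeval v (C a * X 0 ^ 2 + C b * (X 0 * X 1) + C c * X 1 ^ 2 + C d * X 0 +
      C e * X 1 + C f : MvPolynomial (Fin 2) ℚ) = 0} = {v | Q (v - c₀) = ρ} := hZ
  -- every oval is the whole (connected) ellipse, so `k = 1`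
  have hZconn : IsConnected {v : Fin 2 → ℝ | Q (v - c₀) = ρ} :=
    isConnected_setOf_binQF_sub_eq hQ hA hD c₀ hρ
  have hOi : ∀ i, O i = {v | Q (v - c₀) = ρ} := fun i => by
    obtain ⟨v, hv, h⟩ := hO i
    have hv' : v ∈ {v : Fin 2 → ℝ | Q (v - c₀) = ρ} := by rw [← hZ']; exact hv
    rw [h, hZ']
    exact subset_antisymm (connectedComponentIn_subset _ _)
      (hZconn.isPreconnected.subset_connectedComponentIn hv' subset_rfl)
  have hk1 : k = 1 := by
    have hsub : ∀ i j : Fin k, i = j := fun i j => hinj ((hOi i).trans (hOi j).symm)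
    have h1 : Fintype.card (Fin k) ≤ 1 := Fintype.card_le_one_iff.2 hsub
    rw [Fintype.card_fin] at h1
    omega
  subst hk1
  -- the single representation: the inside of the ellipse, of area `2πρ/√D = β π`
  have hdom0 : (s 0).domain = {w | Q (w - c₀) < ρ} := by
    rw [hdom 0, hOi 0, ← ovalInterior_ellipse hQ hA hD c₀ hρ]
    rfl
  have hmeas : MeasurableSet (s 0).domain := by
    rw [hdom0]
    exact (isOpen_lt (continuous_binQF_sub hQ c₀) continuous_const).measurableSet
  have hval : (s 0).value = 2 * Real.pi / Real.sqrt (4 * A * C' - B ^ 2) * ρ := by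
    unfold KZ.IntegralRep.value
    rw [setIntegral_congr_fun hmeas (hone 0), setIntegral_const, smul_eq_mul, mul_one, hdom0,
      volume_real_setOf_binQF_sub_lt hQ hA hD c₀ hρ]
  refine ⟨fun _ => 1, β, fun _ => Or.inl rfl, hβ, hβ0, ?_⟩
  rw [Fin.sum_univ_one, Int.cast_one, one_mul, hval, hβπ]


end Summit.KontsevichZagierPeriods.ComplexOrientations
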